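import Literature.MathematicalPhysics.KineticTheory.HardSphereCanonicalTorus
import HarnessLib

/-!
# Pinned hard-core partition functions on `𝕋³` and the canonical Kirkwood–Salsburg identity

Topic `Literature/MathematicalPhysics/KineticTheory` (companion of `HardSphereCanonicalTorus`,
`HardSphereEulerRatio`; the finite-volume, CANONICAL side of the Kirkwood–Salsburg method of
`StatisticalMechanics/HardSphereKirkwoodSalsburg`).

For the hard-sphere gas of diameter `ε` on the unit flat torus `𝕋³` (uniform activity, overlap
relation `Ov ε` = minimal-image distance `< ε`) and a PINNED configuration `y = (y_a)_{a<k}` we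
consider the probability, under the product Haar measure, that `m` free points avoid the pinned
ones and each other, the pinned ones being themselves mutually compatible:

  `u_ε(y)(m) = Haar^{⊗m} {x | ∀ a ≠ b, d(y_a,y_b) ≥ ε; ∀ i a, d(x_i,y_a) ≥ ε; ∀ i ≠ j, d(x_i,x_j) ≥ ε}`

(`PinnedHC`, `pinnedSet`, `pinnedXi`).  For `k = 0` this is the canonical hard-core probability
`Ξ_ε(m)` of `HardSphereCanonicalTorus` (`pinnedXi_elim0_eq_hcProb`), and
`u_ε(y)(n-k)/Ξ_ε(n)` is, up to the factor `n^k (n-k)!/n!`, the `k`-point correlation function of the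
`n`-particle canonical gas at `y`.  This file proves:

* invariances: relabelling of the pinned points (`pinnedXi_comp_equiv`), translations
  (`pinnedXi_const_add`); the bounds `0 ≤ u ≤ 1`;
* **the transfer recursion** (`pinnedXi_succ_eq_integral`): integrating out one free point turns it
  into a pinned one, `u_ε(y)(m+1) = ∫_{𝕋³} u_ε(insert x₀ into y)(m) dx₀` (any insertion slot);
  monotonicity in the pinned configuration and in `m` (`pinnedXi_insertNth_le`, `pinnedXi_succ_le`,
  `pinnedXi_le_pinnedXi_elim0`);
* **the canonical Kirkwood–Salsburg identity** (`pinnedXi_cons_eq_sum`): peeling the first pinned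
  point by inclusion–exclusion over the free points falling into its exclusion ball,

  `u_ε(y₁ :: y')(m) = 𝟙[y₁ compatible with y'] ·
      ∑_{j=0}^{m} (−1)^j C(m,j) ∫_{(𝕋³)^j} 𝟙[z ⊂ B(y₁,ε)] u_ε(y' ++ z)(m − j) dz`,

  the exact finite-`N`, periodic analogue of Ruelle's equations (2.12)–(2.13) with the activity
  replaced by ratios of canonical partition functions (Bogoliubov–Khatset–Petrina form of the
  Kirkwood–Salsburg equations in the canonical ensemble).  Proof: induction on `m` through the
  transfer recursion and Pascal's rule — no cluster expansion is involved.

## References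

* D. Ruelle, *Statistical Mechanics: Rigorous Results* (1969), §4.2.1 (2.12)–(2.13).  [Ruelle1969]
* E. Pulvirenti, D. Tsagkarogiannis, Comm. Math. Phys. 316 (2012) 289–306, §3 (canonical hard-core
  partition functions on vertex sets).  [PulvirentiTsagkarogiannis2012]

## Not here

No thermodynamic limit (that is the comparison with `HardSphereKS.ksCorr`, elsewhere), no velocity
variables, no non-uniform activity.
-/

noncomputable section

open MeasureTheory Set Filter Function
open scoped ENNReal BigOperators Topology Classical

namespace Literature.MathematicalPhysics.KineticTheory

/-! ### Pinned hard-core configurations -/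

/-- **Pinned hard-core event**: the pinned points `y` are mutually non-overlapping, the free
points `x` avoid the pinned ones, and the free points are mutually non-overlapping (overlap =
minimal-image distance `< ε`). [cite: PulvirentiTsagkarogiannis2012, §3] -/
def PinnedHC (ε : ℝ) {k m : ℕ} (y : Fin k → T3) (x : Fin m → T3) : Prop :=
  (∀ a b : Fin k, a ≠ b → ¬ Ov ε (y a) (y b)) ∧ (∀ (i : Fin m) (a : Fin k), ¬ Ov ε (x i) (y a)) ∧
    ∀ i j : Fin m, i ≠ j → ¬ Ov ε (x i) (x j)

/-- The pinned hard-core set of `m` free points. [cite: PulvirentiTsagkarogiannis2012, §3] -/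
def pinnedSet (ε : ℝ) {k : ℕ} (y : Fin k → T3) (m : ℕ) : Set (Fin m → T3) := {x | PinnedHC ε y x}

/-- **The pinned hard-core probability** `u_ε(y)(m)`: the Haar probability that `m` free points
of `𝕋³` avoid the pinned configuration `y` and each other (and `y` is itself compatible).
[cite: PulvirentiTsagkarogiannis2012, §3] -/
def pinnedXi (ε : ℝ) {k : ℕ} (y : Fin k → T3) (m : ℕ) : ℝ :=
  (volume : Measure (Fin m → T3)).real (pinnedSet ε y m)

/-- `¬ Ov` is symmetric. [folklore] -/
theorem not_ov_comm (ε : ℝ) (a b : T3) : ¬ Ov ε a b ↔ ¬ Ov ε b a :=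
  not_congr ⟨ov_symm ε a b, ov_symm ε b a⟩

/-- A point overlaps itself at every positive scale. [folklore] -/
theorem ov_self {ε : ℝ} (hε : 0 < ε) (a : T3) : Ov ε a a := by
  unfold Ov; rwa [Literature.Analysis.FluidPDE.Torus.euclidDist_self]

/-! ### Measurability -/

/-- The non-overlap event of two measurable `𝕋³`-valued maps is measurable. [folklore] -/
theorem measurableSet_not_ov {Ω : Type*} [MeasurableSpace Ω] (ε : ℝ) {f g : Ω → T3}
    (hf : Measurable f) (hg : Measurable g) : MeasurableSet {ω | ¬ Ov ε (f ω) (g ω)} :=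
  ((measurableSet_ov ε).preimage (hf.prodMk hg)).compl

/-- **Measurability of the pinned hard-core event** along measurable families of pinned and free
configurations. [folklore] -/
theorem measurableSet_setOf_pinnedHC {Ω : Type*} [MeasurableSpace Ω] (ε : ℝ) {k m : ℕ}
    {Y : Ω → Fin k → T3} {X : Ω → Fin m → T3} (hY : Measurable Y) (hX : Measurable X) :
    MeasurableSet {ω | PinnedHC ε (Y ω) (X ω)} := by
  have hYa : ∀ a, Measurable fun ω => Y ω a := fun a => (measurable_pi_apply a).comp hY
  have hXi : ∀ i, Measurable fun ω => X ω i := fun i => (measurable_pi_apply i).comp hX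
  have h1 : MeasurableSet {ω | ∀ a b : Fin k, a ≠ b → ¬ Ov ε (Y ω a) (Y ω b)} := by
    rw [show {ω | ∀ a b : Fin k, a ≠ b → ¬ Ov ε (Y ω a) (Y ω b)} =
        ⋂ a, ⋂ b, {ω | a ≠ b → ¬ Ov ε (Y ω a) (Y ω b)} by ext ω; simp]
    refine MeasurableSet.iInter fun a => MeasurableSet.iInter fun b => ?_
    by_cases hab : a = b
    · simp [hab]
    · simp only [ne_eq, hab, not_false_eq_true, forall_const]
      exact measurableSet_not_ov ε (hYa a) (hYa b)
  have h2 : MeasurableSet {ω | ∀ (i : Fin m) (a : Fin k), ¬ Ov ε (X ω i) (Y ω a)} := by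
    rw [show {ω | ∀ (i : Fin m) (a : Fin k), ¬ Ov ε (X ω i) (Y ω a)} =
        ⋂ i, ⋂ a, {ω | ¬ Ov ε (X ω i) (Y ω a)} by ext ω; simp]
    exact MeasurableSet.iInter fun i => MeasurableSet.iInter fun a =>
      measurableSet_not_ov ε (hXi i) (hYa a)
  have h3 : MeasurableSet {ω | ∀ i j : Fin m, i ≠ j → ¬ Ov ε (X ω i) (X ω j)} := by
    rw [show {ω | ∀ i j : Fin m, i ≠ j → ¬ Ov ε (X ω i) (X ω j)} =
        ⋂ i, ⋂ j, {ω | i ≠ j → ¬ Ov ε (X ω i) (X ω j)} by ext ω; simp]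
    refine MeasurableSet.iInter fun i => MeasurableSet.iInter fun j => ?_
    by_cases hij : i = j
    · simp [hij]
    · simp only [ne_eq, hij, not_false_eq_true, forall_const]
      exact measurableSet_not_ov ε (hXi i) (hXi j)
  have heq : {ω | PinnedHC ε (Y ω) (X ω)} =
      {ω | ∀ a b : Fin k, a ≠ b → ¬ Ov ε (Y ω a) (Y ω b)} ∩
        ({ω | ∀ (i : Fin m) (a : Fin k), ¬ Ov ε (X ω i) (Y ω a)} ∩
          {ω | ∀ i j : Fin m, i ≠ j → ¬ Ov ε (X ω i) (X ω j)}) := by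
    ext ω; simp only [PinnedHC, mem_setOf_eq, mem_inter_iff]
  rw [heq]
  exact h1.inter (h2.inter h3)

/-- The pinned hard-core set is measurable. [folklore] -/
theorem measurableSet_pinnedSet (ε : ℝ) {k : ℕ} (y : Fin k → T3) (m : ℕ) :
    MeasurableSet (pinnedSet ε y m) :=
  measurableSet_setOf_pinnedHC ε measurable_const measurable_id

/-! ### Elementary bounds -/

/-- `0 ≤ u_ε(y)(m)`. [folklore] -/
theorem pinnedXi_nonneg (ε : ℝ) {k : ℕ} (y : Fin k → T3) (m : ℕ) : 0 ≤ pinnedXi ε y m :=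
  measureReal_nonneg

/-- `u_ε(y)(m) ≤ 1`. [folklore] -/
theorem pinnedXi_le_one (ε : ℝ) {k : ℕ} (y : Fin k → T3) (m : ℕ) : pinnedXi ε y m ≤ 1 := by
  rw [pinnedXi, measureReal_def]
  exact (ENNReal.toReal_mono ENNReal.one_ne_top prob_le_one).trans_eq ENNReal.toReal_one

/-- If the pinned configuration is incompatible, `u_ε(y)(m) = 0`. [folklore] -/
theorem pinnedXi_eq_zero_of_ov (ε : ℝ) {k : ℕ} {y : Fin k → T3} {a b : Fin k} (hab : a ≠ b)
    (h : Ov ε (y a) (y b)) (m : ℕ) : pinnedXi ε y m = 0 := by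
  have h0 : pinnedSet ε y m = ∅ := by
    ext x
    simp only [pinnedSet, PinnedHC, mem_setOf_eq, mem_empty_iff_false, iff_false, not_and]
    exact fun h1 => absurd h (h1 a b hab)
  rw [pinnedXi, h0, measureReal_empty]

/-! ### Relabelling and translation invariance -/

/-- Relabelling the pinned points does not change the event. [folklore] -/
theorem pinnedHC_comp_equiv (ε : ℝ) {k k' m : ℕ} (e : Fin k' ≃ Fin k) (y : Fin k → T3)
    (x : Fin m → T3) : PinnedHC ε (y ∘ e) x ↔ PinnedHC ε y x := by
  unfold PinnedHC
  simp only [comp_apply]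
  constructor
  · rintro ⟨h1, h2, h3⟩
    refine ⟨fun a b hab => ?_, fun i a => ?_, h3⟩
    · have := h1 (e.symm a) (e.symm b) (by simpa using hab)
      simpa using this
    · simpa using h2 i (e.symm a)
  · rintro ⟨h1, h2, h3⟩
    exact ⟨fun a b hab => h1 _ _ (e.injective.ne hab), fun i a => h2 i _, h3⟩

/-- **Relabelling invariance**: `u_ε(y ∘ e)(m) = u_ε(y)(m)` for every bijection `e` of labels.
[folklore] -/
theorem pinnedXi_comp_equiv (ε : ℝ) {k k' : ℕ} (e : Fin k' ≃ Fin k) (y : Fin k → T3) (m : ℕ) :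
    pinnedXi ε (y ∘ e) m = pinnedXi ε y m := by
  unfold pinnedXi pinnedSet
  simp_rw [pinnedHC_comp_equiv ε e y]

/-- Relabelling invariance along `Fin.cast`. [folklore] -/
theorem pinnedXi_comp_cast (ε : ℝ) {k k' : ℕ} (h : k' = k) (y : Fin k → T3) (m : ℕ) :
    pinnedXi ε (y ∘ Fin.cast h) m = pinnedXi ε y m :=
  pinnedXi_comp_equiv ε (finCongr h) y m

/-- The pinned event is invariant under a simultaneous translation. [folklore] -/
theorem pinnedHC_const_add_iff (ε : ℝ) {k m : ℕ} (c : T3) (y : Fin k → T3) (x : Fin m → T3) :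
    PinnedHC ε (fun a => c + y a) (fun i => c + x i) ↔ PinnedHC ε y x := by
  simp only [PinnedHC, Ov, euclidDist_add_left]

/-- **Translation invariance**: `u_ε(c + y)(m) = u_ε(y)(m)`. [folklore] -/
theorem pinnedXi_const_add (ε : ℝ) {k : ℕ} (c : T3) (y : Fin k → T3) (m : ℕ) :
    pinnedXi ε (fun a => c + y a) m = pinnedXi ε y m := by
  set e : (Fin m → T3) ≃ᵐ (Fin m → T3) :=
    MeasurableEquiv.piCongrRight fun _ : Fin m => MeasurableEquiv.addLeft c with he
  have hpres : MeasurePreserving e (volume : Measure (Fin m → T3)) volume :=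
    measurePreserving_pi (fun _ : Fin m => (volume : Measure T3)) (fun _ => volume)
      fun _ => measurePreserving_add_left volume c
  have hpre : e ⁻¹' pinnedSet ε (fun a => c + y a) m = pinnedSet ε y m := by
    ext x
    simp only [pinnedSet, mem_preimage, mem_setOf_eq]
    exact pinnedHC_const_add_iff ε c y x
  rw [pinnedXi, pinnedXi, measureReal_def, measureReal_def, ← hpre,
    hpres.measure_preimage (measurableSet_pinnedSet ε _ m).nullMeasurableSet]

/-! ### The transfer recursion: a free point becomes a pinned one -/

/-- Inserting a new pinned point `x₀` (at any slot `p`) and freeing it are the same event: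
`PinnedHC (insert_p x₀ y) x ↔ PinnedHC y (x₀ :: x)`. [folklore] -/
theorem pinnedHC_insertNth_iff (ε : ℝ) {k m : ℕ} (p : Fin (k + 1)) (x₀ : T3) (y : Fin k → T3)
    (x : Fin m → T3) : PinnedHC ε (p.insertNth x₀ y) x ↔ PinnedHC ε y (Fin.cons x₀ x) := by
  constructor
  · rintro ⟨h1, h2, h3⟩
    refine ⟨fun a b hab => ?_, fun i a => ?_, fun i j hij => ?_⟩
    · have h := h1 (p.succAbove a) (p.succAbove b) (fun h => hab (Fin.succAbove_right_inj.1 h))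
      rwa [Fin.insertNth_apply_succAbove, Fin.insertNth_apply_succAbove] at h
    · refine Fin.cases ?_ (fun i' => ?_) i
      · rw [Fin.cons_zero]
        have h := h1 p (p.succAbove a) (Fin.succAbove_ne p a).symm
        rwa [Fin.insertNth_apply_same, Fin.insertNth_apply_succAbove] at h
      · rw [Fin.cons_succ]
        have h := h2 i' (p.succAbove a)
        rwa [Fin.insertNth_apply_succAbove] at h
    · revert hij
      refine Fin.cases ?_ (fun i' => ?_) i <;> refine Fin.cases ?_ (fun j' => ?_) j <;> intro hij
      · exact absurd rfl hij
      · rw [Fin.cons_zero, Fin.cons_succ, not_ov_comm]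
        have h := h2 j' p
        rwa [Fin.insertNth_apply_same] at h
      · rw [Fin.cons_zero, Fin.cons_succ]
        have h := h2 i' p
        rwa [Fin.insertNth_apply_same] at h
      · rw [Fin.cons_succ, Fin.cons_succ]
        exact h3 i' j' fun h => hij (by rw [h])
  · rintro ⟨g1, g2, g3⟩
    refine ⟨fun a b hab => ?_, fun i a => ?_, fun i j hij => ?_⟩
    · rcases Fin.eq_self_or_eq_succAbove p a with ha | ⟨a', ha⟩ <;>
        rcases Fin.eq_self_or_eq_succAbove p b with hb | ⟨b', hb⟩ <;> rw [ha, hb] at hab ⊢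
      · exact absurd rfl hab
      · rw [Fin.insertNth_apply_same, Fin.insertNth_apply_succAbove]
        have h := g2 0 b'
        rwa [Fin.cons_zero] at h
      · rw [Fin.insertNth_apply_same, Fin.insertNth_apply_succAbove, not_ov_comm]
        have h := g2 0 a'
        rwa [Fin.cons_zero] at h
      · rw [Fin.insertNth_apply_succAbove, Fin.insertNth_apply_succAbove]
        exact g1 a' b' fun h => hab (by rw [h])
    · rcases Fin.eq_self_or_eq_succAbove p a with ha | ⟨a', ha⟩ <;> rw [ha]
      · rw [Fin.insertNth_apply_same]
        have h := g3 i.succ 0 (Fin.succ_ne_zero i)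
        rwa [Fin.cons_succ, Fin.cons_zero] at h
      · rw [Fin.insertNth_apply_succAbove]
        have h := g2 i.succ a'
        rwa [Fin.cons_succ] at h
    · have h := g3 i.succ j.succ fun h => hij (Fin.succ_inj.1 h)
      rwa [Fin.cons_succ, Fin.cons_succ] at h

/-- The section of the pinned set of `m + 1` free points at first free coordinate `x₀` is the
pinned set, with `x₀` pinned, of `m` free points. [folklore] -/
theorem cons_mem_pinnedSet_iff (ε : ℝ) {k m : ℕ} (p : Fin (k + 1)) (y : Fin k → T3) (x₀ : T3)
    (x : Fin m → T3) : Fin.cons x₀ x ∈ pinnedSet ε y (m + 1) ↔ x ∈ pinnedSet ε (p.insertNth x₀ y) m :=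
  (pinnedHC_insertNth_iff ε p x₀ y x).symm

/-- Measurability of `x₀ ↦ Haar^{⊗m} (pinnedSet ε (insert_p x₀ y) m)`. [folklore] -/
theorem measurable_volume_pinnedSet_insertNth (ε : ℝ) {k : ℕ} (p : Fin (k + 1)) (y : Fin k → T3)
    (m : ℕ) : Measurable fun x₀ : T3 => (volume : Measure (Fin m → T3)) (pinnedSet ε (p.insertNth x₀ y) m) := by
  have hS : MeasurableSet {q : T3 × (Fin m → T3) | PinnedHC ε (p.insertNth q.1 y) q.2} := by
    refine measurableSet_setOf_pinnedHC ε ?_ measurable_snd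
    refine measurable_pi_iff.2 fun a => ?_
    rcases Fin.eq_self_or_eq_succAbove p a with ha | ⟨a', ha⟩ <;> rw [ha]
    · simp only [Fin.insertNth_apply_same]; exact measurable_fst
    · simp only [Fin.insertNth_apply_succAbove]; exact measurable_const
  exact measurable_measure_prodMk_left hS

/-- **The transfer recursion**: integrating out one free point makes it a pinned point,
`u_ε(y)(m+1) = ∫ u_ε(insert_p x₀ y)(m) dx₀`, for any insertion slot `p`. [folklore] -/
theorem pinnedXi_succ_eq_integral (ε : ℝ) {k : ℕ} (p : Fin (k + 1)) (y : Fin k → T3) (m : ℕ) :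
    pinnedXi ε y (m + 1) = ∫ x₀, pinnedXi ε (p.insertNth x₀ y) m := by
  set e := MeasurableEquiv.piFinSuccAbove (fun _ : Fin (m + 1) => T3) 0 with he
  have hm : MeasurePreserving e (volume : Measure (Fin (m + 1) → T3))
      ((volume : Measure T3).prod (volume : Measure (Fin m → T3))) :=
    volume_preserving_piFinSuccAbove (fun _ : Fin (m + 1) => T3) 0
  have hS : MeasurableSet {q : T3 × (Fin m → T3) | PinnedHC ε (p.insertNth q.1 y) q.2} := by
    refine measurableSet_setOf_pinnedHC ε ?_ measurable_snd
    refine measurable_pi_iff.2 fun a => ?_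
    rcases Fin.eq_self_or_eq_succAbove p a with ha | ⟨a', ha⟩ <;> rw [ha]
    · simp only [Fin.insertNth_apply_same]; exact measurable_fst
    · simp only [Fin.insertNth_apply_succAbove]; exact measurable_const
  have hpre : e.symm ⁻¹' pinnedSet ε y (m + 1) =
      {q : T3 × (Fin m → T3) | PinnedHC ε (p.insertNth q.1 y) q.2} := by
    ext q
    have hq : e.symm q = Fin.cons q.1 q.2 := by
      rw [he, MeasurableEquiv.piFinSuccAbove_symm_apply]
      simp [Fin.insertNthEquiv, Fin.insertNth_zero']
    rw [mem_preimage, hq, mem_setOf_eq]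
    exact cons_mem_pinnedSet_iff ε p y q.1 q.2
  have h1 : (volume : Measure (Fin (m + 1) → T3)) (pinnedSet ε y (m + 1)) =
      ∫⁻ x₀, (volume : Measure (Fin m → T3)) (pinnedSet ε (p.insertNth x₀ y) m) := by
    rw [← hm.symm.measure_preimage (measurableSet_pinnedSet ε y (m + 1)).nullMeasurableSet, hpre,
      Measure.prod_apply hS]
    rfl
  rw [pinnedXi, measureReal_def, h1]
  simp_rw [pinnedXi, measureReal_def]
  rw [integral_toReal (measurable_volume_pinnedSet_insertNth ε p y m).aemeasurable
    (Eventually.of_forall fun x₀ => measure_lt_top _ _)]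

/-- The transfer recursion at the first slot: `u_ε(y)(m+1) = ∫ u_ε(x₀ :: y)(m) dx₀`. [folklore] -/
theorem pinnedXi_succ_eq_integral_cons (ε : ℝ) {k : ℕ} (y : Fin k → T3) (m : ℕ) :
    pinnedXi ε y (m + 1) = ∫ x₀, pinnedXi ε (Fin.cons x₀ y) m := by
  rw [pinnedXi_succ_eq_integral ε 0 y m]
  simp_rw [Fin.insertNth_zero']

/-! ### Monotonicity -/

/-- Pinning one more point shrinks the event. [folklore] -/
theorem pinnedSet_insertNth_subset (ε : ℝ) {k : ℕ} (p : Fin (k + 1)) (x₀ : T3) (y : Fin k → T3)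
    (m : ℕ) : pinnedSet ε (p.insertNth x₀ y) m ⊆ pinnedSet ε y m := by
  rintro x ⟨h1, h2, h3⟩
  refine ⟨fun a b hab => ?_, fun i a => ?_, h3⟩
  · have h := h1 (p.succAbove a) (p.succAbove b) (fun h => hab (Fin.succAbove_right_inj.1 h))
    rwa [Fin.insertNth_apply_succAbove, Fin.insertNth_apply_succAbove] at h
  · have h := h2 i (p.succAbove a)
    rwa [Fin.insertNth_apply_succAbove] at h

/-- **Monotonicity in the pinned configuration**: `u_ε(insert_p x₀ y)(m) ≤ u_ε(y)(m)`. [folklore] -/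
theorem pinnedXi_insertNth_le (ε : ℝ) {k : ℕ} (p : Fin (k + 1)) (x₀ : T3) (y : Fin k → T3) (m : ℕ) :
    pinnedXi ε (p.insertNth x₀ y) m ≤ pinnedXi ε y m :=
  measureReal_mono (pinnedSet_insertNth_subset ε p x₀ y m)

/-- Every pinned event is contained in the unpinned one. [folklore] -/
theorem pinnedSet_subset_pinnedSet_elim0 (ε : ℝ) {k : ℕ} (y : Fin k → T3) (m : ℕ) :
    pinnedSet ε y m ⊆ pinnedSet ε (fun i : Fin 0 => Fin.elim0 i) m := by
  rintro x ⟨-, -, h3⟩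
  exact ⟨fun a => Fin.elim0 a, fun i a => Fin.elim0 a, h3⟩

/-- `u_ε(y)(m) ≤ u_ε(∅)(m) = Ξ_ε(m)`. [folklore] -/
theorem pinnedXi_le_pinnedXi_elim0 (ε : ℝ) {k : ℕ} (y : Fin k → T3) (m : ℕ) :
    pinnedXi ε y m ≤ pinnedXi ε (fun i : Fin 0 => Fin.elim0 i) m :=
  measureReal_mono (pinnedSet_subset_pinnedSet_elim0 ε y m)

/-- **Monotonicity in the number of free points**: `u_ε(y)(m+1) ≤ u_ε(y)(m)`. [folklore] -/
theorem pinnedXi_succ_le (ε : ℝ) {k : ℕ} (y : Fin k → T3) (m : ℕ) :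
    pinnedXi ε y (m + 1) ≤ pinnedXi ε y m := by
  rw [pinnedXi_succ_eq_integral ε 0 y m]
  calc ∫ x₀, pinnedXi ε ((0 : Fin (k + 1)).insertNth x₀ y) m ≤ ∫ _x₀ : T3, pinnedXi ε y m :=
        integral_mono_of_nonneg (Eventually.of_forall fun x₀ => pinnedXi_nonneg ε _ m)
          (integrable_const _) (Eventually.of_forall fun x₀ => pinnedXi_insertNth_le ε 0 x₀ y m)
    _ = pinnedXi ε y m := by rw [integral_const, smul_eq_mul, probReal_univ, one_mul]

/-! ### No free points; no pinned points -/

/-- With no free point, `u_ε(y)(0)` is the indicator that the pinned configuration is compatible.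
[folklore] -/
theorem pinnedXi_zero (ε : ℝ) {k : ℕ} (y : Fin k → T3) :
    pinnedXi ε y 0 = if ∀ a b : Fin k, a ≠ b → ¬ Ov ε (y a) (y b) then 1 else 0 := by
  unfold pinnedXi pinnedSet PinnedHC
  split_ifs with h
  · rw [show {x : Fin 0 → T3 | (∀ a b : Fin k, a ≠ b → ¬ Ov ε (y a) (y b)) ∧
        (∀ (i : Fin 0) (a : Fin k), ¬ Ov ε (x i) (y a)) ∧ ∀ i j : Fin 0, i ≠ j → ¬ Ov ε (x i) (x j)} =
        univ by
          ext x
          simp only [mem_setOf_eq, mem_univ, iff_true]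
          exact ⟨h, fun i => Fin.elim0 i, fun i => Fin.elim0 i⟩]
    exact probReal_univ
  · rw [show {x : Fin 0 → T3 | (∀ a b : Fin k, a ≠ b → ¬ Ov ε (y a) (y b)) ∧
        (∀ (i : Fin 0) (a : Fin k), ¬ Ov ε (x i) (y a)) ∧ ∀ i j : Fin 0, i ≠ j → ¬ Ov ε (x i) (x j)} =
        ∅ by
          ext x
          simp only [mem_setOf_eq, mem_empty_iff_false, iff_false, not_and]
          exact fun h' => absurd h' h]
    rw [measureReal_empty]

/-- **With no pinned point, `u_ε(∅)(m)` is the canonical hard-core probability** `Ξ(univ)` of `m`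
labelled points of `𝕋³` (`hcProb` of `HardCoreCanonical` for the Haar measure). [folklore] -/
theorem pinnedXi_elim0_eq_hcProb (ε : ℝ) (y : Fin 0 → T3) (m : ℕ) :
    pinnedXi ε y m =
      StatisticalMechanics.hcProb (Ov ε) (volume : Measure T3) (Finset.univ : Finset (Fin m)) := by
  unfold pinnedXi StatisticalMechanics.hcProb
  rw [volume_pi]
  congr 1
  ext x
  simp [pinnedSet, PinnedHC, StatisticalMechanics.hardCoreSet]

/-! ### Measurability of the pinned probability along measurable families -/

/-- `ω ↦ Haar^{⊗l}(pinnedSet ε (Y ω) l)` is measurable for a measurable family `Y` of pinned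
configurations. [folklore] -/
theorem measurable_volume_pinnedSet_comp {Ω : Type*} [MeasurableSpace Ω] (ε : ℝ) {k : ℕ}
    {Y : Ω → Fin k → T3} (hY : Measurable Y) (l : ℕ) :
    Measurable fun ω => (volume : Measure (Fin l → T3)) (pinnedSet ε (Y ω) l) :=
  measurable_measure_prodMk_left (measurableSet_setOf_pinnedHC ε (hY.comp measurable_fst) measurable_snd)

/-- `ω ↦ u_ε(Y ω)(l)` is measurable for a measurable family `Y`. [folklore] -/
theorem measurable_pinnedXi_comp {Ω : Type*} [MeasurableSpace Ω] (ε : ℝ) {k : ℕ}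
    {Y : Ω → Fin k → T3} (hY : Measurable Y) (l : ℕ) : Measurable fun ω => pinnedXi ε (Y ω) l :=
  (measurable_volume_pinnedSet_comp ε hY l).ennreal_toReal

/-! ### The ball and wall indicators of the Kirkwood–Salsburg identity -/

/-- `𝟙[all z_i overlap y₁]`: the `j` removed free points lie in the exclusion ball of `y₁`
(Ruelle's `|K(y₁, (z)_j)|`). [cite: Ruelle1969, §4.2.1 (2.9)] -/
def ballInd (ε : ℝ) (y₁ : T3) {j : ℕ} (z : Fin j → T3) : ℝ := if ∀ i, Ov ε (z i) y₁ then 1 else 0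

/-- `𝟙[y₁ is compatible with the other pinned points]` (Ruelle's `e^{−βW¹}`).
[cite: Ruelle1969, §4.2.1 (2.6)] -/
def wallInd (ε : ℝ) (y₁ : T3) {k : ℕ} (y' : Fin k → T3) : ℝ := if ∀ a, ¬ Ov ε y₁ (y' a) then 1 else 0

/-- The `j`-th Kirkwood–Salsburg integral `J(j, l) = ∫_{(𝕋³)^j} 𝟙[z ⊂ B(y₁,ε)] u_ε(y' ++ z)(l) dz`.
[cite: Ruelle1969, §4.2.1 (2.13)] -/
def ksJ (ε : ℝ) (y₁ : T3) {k : ℕ} (y' : Fin k → T3) (j l : ℕ) : ℝ :=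
  ∫ z : Fin j → T3, ballInd ε y₁ z * pinnedXi ε (Fin.append y' z) l

/-- `0 ≤ ballInd ≤ 1`. [folklore] -/
theorem ballInd_mem_Icc (ε : ℝ) (y₁ : T3) {j : ℕ} (z : Fin j → T3) : ballInd ε y₁ z ∈ Icc (0 : ℝ) 1 := by
  unfold ballInd; split_ifs <;> norm_num

/-- `0 ≤ wallInd ≤ 1`. [folklore] -/
theorem wallInd_mem_Icc (ε : ℝ) (y₁ : T3) {k : ℕ} (y' : Fin k → T3) :
    wallInd ε y₁ y' ∈ Icc (0 : ℝ) 1 := by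
  unfold wallInd; split_ifs <;> norm_num

/-- The ball indicator is a set indicator. [folklore] -/
theorem ballInd_eq_indicator (ε : ℝ) (y₁ : T3) {j : ℕ} (z : Fin j → T3) :
    ballInd ε y₁ z = ({z : Fin j → T3 | ∀ i, Ov ε (z i) y₁}).indicator 1 z := by
  unfold ballInd
  by_cases h : ∀ i, Ov ε (z i) y₁
  · rw [if_pos h, indicator_of_mem (by exact h), Pi.one_apply]
  · rw [if_neg h, indicator_of_notMem (by exact h)]

/-- The overlap event of two measurable `𝕋³`-valued maps is measurable. [folklore] -/
theorem measurableSet_ov_comp {Ω : Type*} [MeasurableSpace Ω] (ε : ℝ) {f g : Ω → T3}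
    (hf : Measurable f) (hg : Measurable g) : MeasurableSet {ω | Ov ε (f ω) (g ω)} := by
  have h := (measurableSet_not_ov ε hf hg).compl
  simp only [compl_setOf, not_not] at h
  exact h

/-- The ball event is measurable. [folklore] -/
theorem measurableSet_ball (ε : ℝ) (y₁ : T3) (j : ℕ) :
    MeasurableSet {z : Fin j → T3 | ∀ i, Ov ε (z i) y₁} := by
  have hi : ∀ i : Fin j, MeasurableSet {z : Fin j → T3 | Ov ε (z i) y₁} := fun i =>
    measurableSet_ov_comp ε (measurable_pi_apply i) measurable_const
  rw [show {z : Fin j → T3 | ∀ i, Ov ε (z i) y₁} = ⋂ i, {z | Ov ε (z i) y₁} by ext z; simp]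
  exact MeasurableSet.iInter hi

/-- The ball indicator is measurable. [folklore] -/
theorem measurable_ballInd (ε : ℝ) (y₁ : T3) (j : ℕ) :
    Measurable fun z : Fin j → T3 => ballInd ε y₁ z := by
  have h : (fun z : Fin j → T3 => ballInd ε y₁ z) = ({z : Fin j → T3 | ∀ i, Ov ε (z i) y₁}).indicator 1 :=
    funext fun z => ballInd_eq_indicator ε y₁ z
  rw [h]
  exact measurable_one.indicator (measurableSet_ball ε y₁ j)

/-- Measurability of the ball indicator along a measurable family. [folklore] -/
theorem measurable_ballInd_comp {Ω : Type*} [MeasurableSpace Ω] (ε : ℝ) (y₁ : T3) {j : ℕ}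
    {Z : Ω → Fin j → T3} (hZ : Measurable Z) : Measurable fun ω => ballInd ε y₁ (Z ω) :=
  (measurable_ballInd ε y₁ j).comp hZ

/-- The ball indicator of `x₀ :: z` factors. [folklore] -/
theorem ballInd_cons (ε : ℝ) (y₁ x₀ : T3) {j : ℕ} (z : Fin j → T3) :
    ballInd ε y₁ (Fin.cons x₀ z) = (if Ov ε x₀ y₁ then 1 else 0) * ballInd ε y₁ z := by
  have key : (∀ i : Fin (j + 1), Ov ε ((Fin.cons x₀ z : Fin (j + 1) → T3) i) y₁) ↔
      Ov ε x₀ y₁ ∧ ∀ i, Ov ε (z i) y₁ := by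
    rw [Fin.forall_fin_succ]; simp only [Fin.cons_zero, Fin.cons_succ]
  simp only [ballInd, key]
  by_cases h0 : Ov ε x₀ y₁ <;> by_cases h1 : ∀ i, Ov ε (z i) y₁ <;> simp [h0, h1]

/-- The wall indicator of `snoc y' x₀` factors. [folklore] -/
theorem wallInd_snoc (ε : ℝ) (y₁ x₀ : T3) {k : ℕ} (y' : Fin k → T3) :
    wallInd ε y₁ (Fin.snoc y' x₀) = wallInd ε y₁ y' * (if Ov ε x₀ y₁ then 0 else 1) := by
  have key : (∀ a : Fin (k + 1), ¬ Ov ε y₁ ((Fin.snoc y' x₀ : Fin (k + 1) → T3) a)) ↔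
      (∀ a, ¬ Ov ε y₁ (y' a)) ∧ ¬ Ov ε x₀ y₁ := by
    rw [Fin.forall_fin_succ']; simp only [Fin.snoc_castSucc, Fin.snoc_last, not_ov_comm ε y₁ x₀]
  simp only [wallInd, key]
  by_cases h0 : Ov ε x₀ y₁ <;> by_cases h1 : ∀ a, ¬ Ov ε y₁ (y' a) <;> simp [h0, h1]

/-- `|ballInd · u| ≤ 1`. [folklore] -/
theorem abs_ballInd_mul_pinnedXi_le (ε : ℝ) (y₁ : T3) {j k : ℕ} (z : Fin j → T3) (w : Fin k → T3)
    (l : ℕ) : |ballInd ε y₁ z * pinnedXi ε w l| ≤ 1 := by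
  rw [abs_mul, abs_of_nonneg (ballInd_mem_Icc ε y₁ z).1, abs_of_nonneg (pinnedXi_nonneg ε w l)]
  exact mul_le_one₀ (ballInd_mem_Icc ε y₁ z).2 (pinnedXi_nonneg ε w l) (pinnedXi_le_one ε w l)

/-! ### Two `Fin.append` identities -/

/-- Inserting `x₀` right after the prefix `y'` of `y' ++ z` gives `y' ++ (x₀ :: z)`. [folklore] -/
theorem insertNth_natAdd_zero_append {α : Type*} {k j : ℕ} (x₀ : α) (y' : Fin k → α)
    (z : Fin j → α) :
    (Fin.natAdd k (0 : Fin (j + 1))).insertNth x₀ (Fin.append y' z) = Fin.append y' (Fin.cons x₀ z) := by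
  set p : Fin (k + j + 1) := Fin.natAdd k (0 : Fin (j + 1)) with hp
  have hpv : (p : ℕ) = k := by simp [hp]
  funext i
  rcases Fin.eq_self_or_eq_succAbove p i with hi | ⟨i', hi⟩ <;> rw [hi]
  · rw [Fin.insertNth_apply_same, hp, Fin.append_right, Fin.cons_zero]
  · rw [Fin.insertNth_apply_succAbove]
    refine Fin.addCases (fun a => ?_) (fun b => ?_) i'
    · have hlt : Fin.castSucc (Fin.castAdd j a) < p := by
        rw [Fin.lt_def, hpv]; simp
      rw [Fin.succAbove_of_castSucc_lt p _ hlt, Fin.castSucc_castAdd, Fin.append_left,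
        Fin.append_left]
    · have hle : p ≤ Fin.castSucc (Fin.natAdd k b) := by
        rw [Fin.le_def, hpv]; simp
      rw [Fin.succAbove_of_le_castSucc p _ hle, Fin.succ_natAdd, Fin.append_right, Fin.append_right,
        Fin.cons_succ]

/-- `u_ε((y' :+ x₀) ++ z) = u_ε(y' ++ (x₀ :: z))` (same pinned points, relabelled). [folklore] -/
theorem pinnedXi_append_snoc (ε : ℝ) {k j : ℕ} (y' : Fin k → T3) (x₀ : T3) (z : Fin j → T3) (l : ℕ) :
    pinnedXi ε (Fin.append (Fin.snoc y' x₀) z) l = pinnedXi ε (Fin.append y' (Fin.cons x₀ z)) l := by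
  rw [Fin.append_right_cons, pinnedXi_comp_cast]

/-! ### Measurability of appended families -/

/-- `z ↦ y' ++ z` is measurable. [folklore] -/
theorem measurable_append_right_T3 {k j : ℕ} (y' : Fin k → T3) :
    Measurable fun z : Fin j → T3 => Fin.append y' z := by
  refine measurable_pi_iff.2 fun i => ?_
  refine Fin.addCases (fun a => ?_) (fun b => ?_) i
  · simp only [Fin.append_left]; exact measurable_const
  · simp only [Fin.append_right]; exact measurable_pi_apply b

/-- `(x₀, z) ↦ x₀ :: z` is measurable. [folklore] -/
theorem measurable_cons_prod {j : ℕ} :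
    Measurable fun q : T3 × (Fin j → T3) => (Fin.cons q.1 q.2 : Fin (j + 1) → T3) := by
  refine measurable_pi_iff.2 fun i => ?_
  refine Fin.cases ?_ (fun i' => ?_) i
  · simp only [Fin.cons_zero]; exact measurable_fst
  · simp only [Fin.cons_succ]; exact (measurable_pi_apply i').comp measurable_snd

/-- `(x₀, z) ↦ y' ++ (x₀ :: z)` is measurable. [folklore] -/
theorem measurable_append_cons_prod {k j : ℕ} (y' : Fin k → T3) :
    Measurable fun q : T3 × (Fin j → T3) => Fin.append y' (Fin.cons q.1 q.2 : Fin (j + 1) → T3) :=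
  (measurable_append_right_T3 y').comp measurable_cons_prod

/-! ### The two integrals of the induction step -/

section Step

variable (ε : ℝ) (y₁ : T3) {k : ℕ} (y' : Fin k → T3)

/-- The integrand `H_j(x₀, z) = 𝟙[z ⊂ B(y₁)] u_ε(y' ++ (x₀ :: z))(l)` of the induction step. [folklore] -/
def stepH (j l : ℕ) (q : T3 × (Fin j → T3)) : ℝ :=
  ballInd ε y₁ q.2 * pinnedXi ε (Fin.append y' (Fin.cons q.1 q.2 : Fin (j + 1) → T3)) l

/-- `H_j` is measurable. [folklore] -/
theorem measurable_stepH (j l : ℕ) : Measurable (stepH ε y₁ y' j l) :=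
  (measurable_ballInd_comp ε y₁ measurable_snd).mul
    (measurable_pinnedXi_comp ε (measurable_append_cons_prod y') l)

/-- `|H_j| ≤ 1`. [folklore] -/
theorem abs_stepH_le (j l : ℕ) (q : T3 × (Fin j → T3)) : |stepH ε y₁ y' j l q| ≤ 1 :=
  abs_ballInd_mul_pinnedXi_le ε y₁ q.2 _ l

/-- `H_j` is integrable on `𝕋³ × (𝕋³)^j`. [folklore] -/
theorem integrable_stepH (j l : ℕ) :
    Integrable (stepH ε y₁ y' j l) ((volume : Measure T3).prod (volume : Measure (Fin j → T3))) :=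
  (integrable_const (1 : ℝ)).mono' (measurable_stepH ε y₁ y' j l).aestronglyMeasurable
    (Eventually.of_forall fun q => by rw [Real.norm_eq_abs]; exact abs_stepH_le ε y₁ y' j l q)

/-- The overlap indicator `x₀ ↦ 𝟙[x₀ overlaps y₁]` is measurable. [folklore] -/
theorem measurable_ovInd : Measurable fun x₀ : T3 => (if Ov ε x₀ y₁ then (1 : ℝ) else 0) := by
  have h : (fun x₀ : T3 => (if Ov ε x₀ y₁ then (1 : ℝ) else 0)) = ({x₀ : T3 | Ov ε x₀ y₁}).indicator 1 := by
    funext x₀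
    by_cases hx : Ov ε x₀ y₁
    · rw [if_pos hx, indicator_of_mem (by exact hx), Pi.one_apply]
    · rw [if_neg hx, indicator_of_notMem (by exact hx)]
  rw [h]
  exact measurable_one.indicator (measurableSet_ov_comp ε measurable_id measurable_const)

/-- `𝟙[x₀ overlaps y₁] H_j` is integrable. [folklore] -/
theorem integrable_ovInd_mul_stepH (j l : ℕ) :
    Integrable (fun q : T3 × (Fin j → T3) => (if Ov ε q.1 y₁ then (1 : ℝ) else 0) * stepH ε y₁ y' j l q)
      ((volume : Measure T3).prod (volume : Measure (Fin j → T3))) := by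
  refine (integrable_const (1 : ℝ)).mono' ((((measurable_ovInd ε y₁).comp measurable_fst).mul
    (measurable_stepH ε y₁ y' j l))).aestronglyMeasurable (Eventually.of_forall fun q => ?_)
  rw [Real.norm_eq_abs, abs_mul]
  have h1 : |(if Ov ε q.1 y₁ then (1 : ℝ) else 0)| ≤ 1 := by split_ifs <;> simp
  exact mul_le_one₀ h1 (abs_nonneg _) (abs_stepH_le ε y₁ y' j l q)

/-- **Term A of the induction step**: integrating the transferred point out again,
`∫∫ H_j(x₀, z) dz dx₀ = J(j, l+1)`. [folklore] -/
theorem integral_integral_stepH (j l : ℕ) :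
    ∫ x₀, ∫ z, stepH ε y₁ y' j l (x₀, z) = ksJ ε y₁ y' j (l + 1) := by
  rw [integral_integral_swap (f := fun x₀ z => stepH ε y₁ y' j l (x₀, z))
    (by exact integrable_stepH ε y₁ y' j l)]
  unfold ksJ
  refine integral_congr_ae (Eventually.of_forall fun z => ?_)
  simp only [stepH]
  set p : Fin (k + j + 1) := Fin.natAdd k (0 : Fin (j + 1)) with hp
  rw [integral_const_mul, pinnedXi_succ_eq_integral ε p (Fin.append y' z) l]
  simp_rw [hp, insertNth_natAdd_zero_append]

/-- **Term B of the induction step**: the transferred point joins the ball points,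
`∫ 𝟙[x₀ ∈ B(y₁)] ∫ H_j(x₀, z) dz dx₀ = J(j+1, l)`. [folklore] -/
theorem integral_ovInd_integral_stepH (j l : ℕ) :
    ∫ x₀, (if Ov ε x₀ y₁ then (1 : ℝ) else 0) * ∫ z, stepH ε y₁ y' j l (x₀, z) = ksJ ε y₁ y' (j + 1) l := by
  set e := MeasurableEquiv.piFinSuccAbove (fun _ : Fin (j + 1) => T3) 0 with he
  have hm : MeasurePreserving e (volume : Measure (Fin (j + 1) → T3))
      ((volume : Measure T3).prod (volume : Measure (Fin j → T3))) :=
    volume_preserving_piFinSuccAbove (fun _ : Fin (j + 1) => T3) 0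
  have hsymm : ∀ q : T3 × (Fin j → T3), e.symm q = Fin.cons q.1 q.2 := fun q => by
    rw [he, MeasurableEquiv.piFinSuccAbove_symm_apply]
    simp [Fin.insertNthEquiv, Fin.insertNth_zero']
  unfold ksJ
  rw [← hm.symm.integral_comp', integral_prod _ ((integrable_ovInd_mul_stepH ε y₁ y' j l).congr
    (Eventually.of_forall fun q => ?_))]
  · refine integral_congr_ae (Eventually.of_forall fun x₀ => ?_)
    simp only
    rw [← integral_const_mul]
    refine integral_congr_ae (Eventually.of_forall fun z => ?_)
    simp only [hsymm, ballInd_cons, stepH]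
    ring
  · simp only [hsymm, ballInd_cons, stepH]
    ring

/-- `x₀ ↦ ∫ H_j(x₀, z) dz` is integrable. [folklore] -/
theorem integrable_integral_stepH (j l : ℕ) :
    Integrable fun x₀ : T3 => ∫ z, stepH ε y₁ y' j l (x₀, z) :=
  (integrable_stepH ε y₁ y' j l).integral_prod_left

/-- `x₀ ↦ 𝟙[x₀ ∈ B(y₁)] ∫ H_j(x₀, z) dz` is integrable. [folklore] -/
theorem integrable_ovInd_mul_integral_stepH (j l : ℕ) :
    Integrable fun x₀ : T3 => (if Ov ε x₀ y₁ then (1 : ℝ) else 0) * ∫ z, stepH ε y₁ y' j l (x₀, z) := by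
  have h := (integrable_ovInd_mul_stepH ε y₁ y' j l).integral_prod_left
  refine h.congr (Eventually.of_forall fun x₀ => ?_)
  simp only
  exact integral_const_mul (if Ov ε x₀ y₁ then (1 : ℝ) else 0) fun z => stepH ε y₁ y' j l (x₀, z)

end Step

/-! ### Pascal's rule for the alternating Kirkwood–Salsburg sums -/

/-- The combinatorial step: `∑_{j ≤ m+1} (−1)^j C(m+1,j) J(j, m+1−j) =
∑_{j ≤ m} (−1)^j C(m,j) J(j, m+1−j) − ∑_{j ≤ m} (−1)^j C(m,j) J(j+1, m−j)`. [folklore] -/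
theorem pascal_alternating_sum (m : ℕ) (J : ℕ → ℕ → ℝ) :
    ∑ j ∈ Finset.range (m + 1 + 1), (-1 : ℝ) ^ j * ((m + 1).choose j : ℝ) * J j (m + 1 - j) =
      ∑ j ∈ Finset.range (m + 1), (-1 : ℝ) ^ j * (m.choose j : ℝ) * J j (m + 1 - j) -
        ∑ j ∈ Finset.range (m + 1), (-1 : ℝ) ^ j * (m.choose j : ℝ) * J (j + 1) (m - j) := by
  -- peel `j = 0` on the left and use Pascal's rule on the shifted terms
  rw [Finset.sum_range_succ' _ (m + 1)]
  have hshift : ∀ j ∈ Finset.range (m + 1),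
      (-1 : ℝ) ^ (j + 1) * ((m + 1).choose (j + 1) : ℝ) * J (j + 1) (m + 1 - (j + 1)) =
        -((-1 : ℝ) ^ j * (m.choose j : ℝ) * J (j + 1) (m - j)) +
          (-1 : ℝ) ^ (j + 1) * (m.choose (j + 1) : ℝ) * J (j + 1) (m - j) := by
    intro j _
    rw [Nat.choose_succ_succ', Nat.cast_add, Nat.add_sub_add_right, pow_succ]
    ring
  rw [Finset.sum_congr rfl hshift, Finset.sum_add_distrib, Finset.sum_neg_distrib]
  -- the second shifted sum, extended by the vanishing `j = m + 1` term, is the first right sum minus `j = 0`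
  have hsecond : ∑ j ∈ Finset.range (m + 1), (-1 : ℝ) ^ (j + 1) * (m.choose (j + 1) : ℝ) * J (j + 1) (m - j)
      + (-1 : ℝ) ^ 0 * ((m + 1).choose 0 : ℝ) * J 0 (m + 1 - 0) =
      ∑ j ∈ Finset.range (m + 1), (-1 : ℝ) ^ j * (m.choose j : ℝ) * J j (m + 1 - j) := by
    rw [Finset.sum_range_succ' (fun j => (-1 : ℝ) ^ j * (m.choose j : ℝ) * J j (m + 1 - j)) m,
      Finset.sum_range_succ (fun j => (-1 : ℝ) ^ (j + 1) * (m.choose (j + 1) : ℝ) * J (j + 1) (m - j)) m]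
    simp [Nat.choose_succ_self]
  linarith [hsecond]

/-! ### The canonical Kirkwood–Salsburg identity -/

/-- Compatibility of `y₁ :: y'` splits into the wall condition and compatibility of `y'`. [folklore] -/
theorem cons_compat_iff (ε : ℝ) (y₁ : T3) {k : ℕ} (y' : Fin k → T3) :
    (∀ a b : Fin (k + 1), a ≠ b →
        ¬ Ov ε ((Fin.cons y₁ y' : Fin (k + 1) → T3) a) ((Fin.cons y₁ y' : Fin (k + 1) → T3) b)) ↔
      (∀ a, ¬ Ov ε y₁ (y' a)) ∧ ∀ a b : Fin k, a ≠ b → ¬ Ov ε (y' a) (y' b) := by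
  constructor
  · intro h
    refine ⟨fun a => ?_, fun a b hab => ?_⟩
    · have h' := h 0 a.succ (Fin.succ_ne_zero a).symm
      rwa [Fin.cons_zero, Fin.cons_succ] at h'
    · have h' := h a.succ b.succ fun e => hab (Fin.succ_inj.1 e)
      rwa [Fin.cons_succ, Fin.cons_succ] at h'
  · rintro ⟨h1, h2⟩ a b hab
    revert hab
    refine Fin.cases ?_ (fun a' => ?_) a <;> refine Fin.cases ?_ (fun b' => ?_) b <;> intro hab
    · exact absurd rfl hab
    · rw [Fin.cons_zero, Fin.cons_succ]; exact h1 b'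
    · rw [Fin.cons_succ, Fin.cons_zero, not_ov_comm]; exact h1 a'
    · rw [Fin.cons_succ, Fin.cons_succ]; exact h2 a' b' fun e => hab (by rw [e])

/-- `J(0, 0) = 𝟙[y' compatible]`. [folklore] -/
theorem ksJ_zero_zero (ε : ℝ) (y₁ : T3) {k : ℕ} (y' : Fin k → T3) :
    ksJ ε y₁ y' 0 0 = if ∀ a b : Fin k, a ≠ b → ¬ Ov ε (y' a) (y' b) then 1 else 0 := by
  unfold ksJ
  have hconst : ∀ z : Fin 0 → T3, ballInd ε y₁ z * pinnedXi ε (Fin.append y' z) 0 =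
      if ∀ a b : Fin k, a ≠ b → ¬ Ov ε (y' a) (y' b) then 1 else 0 := by
    intro z
    have hb : ballInd ε y₁ z = 1 := by unfold ballInd; rw [if_pos fun i => Fin.elim0 i]
    rw [hb, one_mul, Fin.append_right_nil y' z rfl, pinnedXi_comp_cast, pinnedXi_zero]
  simp_rw [hconst]
  rw [integral_const, smul_eq_mul, probReal_univ, one_mul]

/-- **The canonical Kirkwood–Salsburg identity on `𝕋³`.**  For the hard-sphere gas of diameter
`ε` on the unit torus, the pinned hard-core probabilities satisfy, for every pinned point `y₁`,
every further pinned configuration `y'` and every number `m` of free points,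

  `u_ε(y₁ :: y')(m) = 𝟙[y₁ ∼ y'] ∑_{j=0}^{m} (−1)^j C(m, j) ∫_{(𝕋³)^j} 𝟙[z ⊂ B(y₁, ε)] u_ε(y' ++ z)(m − j) dz` :

inclusion–exclusion over the set of free points which fall into the exclusion ball of `y₁`
(Ruelle (2.8)–(2.13) with `K(y₁, (z)_j) = (−1)^j 𝟙[z ⊂ B(y₁,ε)]` and `e^{−βW¹} = 𝟙[y₁ ∼ y']`), in
the canonical ensemble and finite volume: an exact identity, proved by induction on `m` through the
transfer recursion (`pinnedXi_succ_eq_integral`) and Pascal's rule. [cite: Ruelle1969, §4.2.1 (2.13)] -/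
theorem pinnedXi_cons_eq_sum (ε : ℝ) (y₁ : T3) (m : ℕ) :
    ∀ {k : ℕ} (y' : Fin k → T3), pinnedXi ε (Fin.cons y₁ y') m =
      wallInd ε y₁ y' * ∑ j ∈ Finset.range (m + 1),
        (-1 : ℝ) ^ j * (m.choose j : ℝ) * ksJ ε y₁ y' j (m - j) := by
  induction m with
  | zero =>
    intro k y'
    rw [Finset.sum_range_one, pow_zero, Nat.choose_zero_right, Nat.cast_one, one_mul, one_mul,
      Nat.sub_zero, ksJ_zero_zero, pinnedXi_zero]
    unfold wallInd
    by_cases h1 : ∀ a, ¬ Ov ε y₁ (y' a) <;>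
      by_cases h2 : ∀ a b : Fin k, a ≠ b → ¬ Ov ε (y' a) (y' b) <;> simp [cons_compat_iff, h1, h2]
  | succ m ih =>
    intro k y'
    -- the coefficients and the two families of one-point integrals
    set c : ℕ → ℝ := fun j => (-1 : ℝ) ^ j * (m.choose j : ℝ) with hc
    set IA : ℕ → T3 → ℝ := fun j x₀ => ∫ z, stepH ε y₁ y' j (m - j) (x₀, z) with hIA
    set IB : ℕ → T3 → ℝ := fun j x₀ =>
      (if Ov ε x₀ y₁ then (1 : ℝ) else 0) * ∫ z, stepH ε y₁ y' j (m - j) (x₀, z) with hIB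
    -- Step 1: transfer recursion at the last slot, induction hypothesis, wall factorisation
    have h1 : pinnedXi ε (Fin.cons y₁ y') (m + 1) =
        ∫ x₀, wallInd ε y₁ y' * (∑ j ∈ Finset.range (m + 1), c j * IA j x₀ -
          ∑ j ∈ Finset.range (m + 1), c j * IB j x₀) := by
      rw [pinnedXi_succ_eq_integral ε (Fin.last (k + 1)) (Fin.cons y₁ y') m]
      refine integral_congr_ae (Eventually.of_forall fun x₀ => ?_)
      simp only
      rw [Fin.insertNth_last', ← Fin.cons_snoc_eq_snoc_cons, ih (Fin.snoc y' x₀), wallInd_snoc,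
        mul_assoc]
      congr 1
      rw [Finset.mul_sum, ← Finset.sum_sub_distrib]
      refine Finset.sum_congr rfl fun j _ => ?_
      simp only [hc, hIA, hIB, ksJ, stepH]
      simp_rw [pinnedXi_append_snoc]
      split_ifs <;> ring
    -- Step 2: linearity of the integral
    have hA : ∀ j ∈ Finset.range (m + 1), Integrable (fun x₀ : T3 => c j * IA j x₀) := fun j _ =>
      (integrable_integral_stepH ε y₁ y' j (m - j)).const_mul _
    have hB : ∀ j ∈ Finset.range (m + 1), Integrable (fun x₀ : T3 => c j * IB j x₀) := fun j _ =>
      (integrable_ovInd_mul_integral_stepH ε y₁ y' j (m - j)).const_mul _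
    have h2 : ∫ x₀, wallInd ε y₁ y' * (∑ j ∈ Finset.range (m + 1), c j * IA j x₀ -
          ∑ j ∈ Finset.range (m + 1), c j * IB j x₀) =
        wallInd ε y₁ y' * ((∑ j ∈ Finset.range (m + 1), c j * ∫ x₀, IA j x₀) -
          ∑ j ∈ Finset.range (m + 1), c j * ∫ x₀, IB j x₀) := by
      rw [integral_const_mul, integral_sub (integrable_finsetSum _ hA) (integrable_finsetSum _ hB),
        integral_finsetSum _ hA, integral_finsetSum _ hB]
      congr 1
      congr 1 <;> exact Finset.sum_congr rfl fun j _ => integral_const_mul _ _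
    -- Step 3: the two one-point integrals
    have h3A : ∀ j ∈ Finset.range (m + 1), c j * ∫ x₀, IA j x₀ = c j * ksJ ε y₁ y' j (m + 1 - j) := by
      intro j hj
      rw [hIA]
      simp only
      rw [integral_integral_stepH, Nat.succ_sub (Finset.mem_range_succ_iff.1 hj)]
    have h3B : ∀ j ∈ Finset.range (m + 1), c j * ∫ x₀, IB j x₀ = c j * ksJ ε y₁ y' (j + 1) (m - j) := by
      intro j _
      rw [hIB]
      simp only
      rw [integral_ovInd_integral_stepH]
    -- Step 4: Pascal's rule
    have hP := pascal_alternating_sum m fun a b => ksJ ε y₁ y' a b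
    rw [h1, h2, hP]
    congr 1
    congr 1
    · exact Finset.sum_congr rfl h3A
    · exact Finset.sum_congr rfl h3B

end Literature.MathematicalPhysics.KineticTheory
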